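import Literature.AlgebraicGeometry.Motives.FrobeniusSemisimplePoincareDuality
import HarnessLib

/-!
# Varieties dominated by products of abelian varieties or curves: semisimplicity of Frobenius and
# Tate's condition `S` (Kahn 2003 Lemme 1.9 «varieties of abelian type»; Kahn 2020 §6.14)

Topic `Literature/AlgebraicGeometry/Motives`; THEOREMS ONLY (no definition, no instance, no named
fact; D-0026).

B. Kahn, *Équivalences rationnelle et numérique sur certaines variétés de type abélien sur un corps
fini*, Ann. Sci. ÉNS 36 (2003), p. 982 (quoted verbatim in the tree's
`AlgebraicGeometry/Kahn2003/RationalNumericalEquivalenceOfTate`): «LEMME 1.9. Pour tout `M ∈ A_ab`,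
l'action de Frobenius sur `H_l(M)` est semi-simple.» — `A_ab` being the thick rigid subcategory of
motives generated by Artin motives and motives of abelian varieties («ou de courbes, c'est la même
chose»), which contains the motive of every variety DOMINATED by a product of abelian varieties or
curves (a direct summand, Kahn 2020 Lemma 6.30 (2); gen-36 `DominatedVarietiesDirectSummand`).
B. Kahn (2020) §6.14 p. 132: «We clearly have `SS^{2i}(X, l) ⟹ S^i(X, l)`», Th. 6.54
«`S^d(X × X, l) ⟺ SS^i(X, l)` for all `i`».

For the tree's abstract `E : GaloisWeilCohomology k K χ` a DOMINATION of `U` by `V` is a morphism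
`f : V ⟶ U` of smooth projective varieties with a rational algebraic class `ζ ∈ Aʳ(V)_ℚ` such that
`f₊ζ ≠ 0` (gen 36; then `f* : H^*(U) → H^*(V)` is injective and equivariant). Assembling rows
g38-#2 (dominations, Künneth), g38-#4 (abelian varieties), g38-#8 (curves) and g38-#3 («SS ⟹ S»,
Th. 6.54 ⟸), this file proves, with Weil's `SS(H¹)` of the abelian varieties ∕ curves as the only
hypothesis on the Galois action:

* §1 any `σ ∈ Γ_k`: `U` dominated by an abelian variety `A`, by `A × B`, by a curve `C` or by
  `C₁ × C₂` with `SS(H¹)` of the factors ⟹ `σ` acts semisimply on all of `H^*(U)`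
  (`forall_isSemisimple_ρ_of_dominated_by_abelianVariety`, `…_prod_abelianVariety`, `…_curve`,
  `…_prod_curve`); equidimensional generically finite maps (`f*` non-zero in top degree) likewise.
* §2 `k` finite, Frobenius: the same for `E.frobAction`, and the consequences — `S` for every
  twisted Frobenius on `H^*(U)` and on `H^*(U × U)` and the strong Tate condition `S^{dim U}(U × U)`
  of Th. 6.54 (`…ker_inf_range_eq_bot…`, `self_product_strongTate_of_dominated_by_…`).

## Provenance

Lane `lit-hodgefound` (summit `HodgeConjecture`, Track 2 foundations library, Layer B: motives),
seat `lit-hodgefound-p29` (literature-prover, generation 38, row g38-#9).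
-/

universe u v

open CategoryTheory AlgebraicGeometry MonoidalCategory CartesianMonoidalCategory

noncomputable section

namespace Literature.AlgebraicGeometry.Motives

open Literature.LinearAlgebra

namespace GaloisWeilCohomology

variable {k : Type u} [Field k] {K : Type v} [Field K] [CharZero K]
  {χ : Field.absoluteGaloisGroup k →* Kˣ} (E : GaloisWeilCohomology k K χ)
variable {M : ℕ} {U : SchemeOver k}

/-! ## §1 Any `σ ∈ Γ_k` -/

section Galois

variable {g g' : ℕ} (A B : AbelianVariety k)

/-- **`U` dominated by an abelian variety with `SS(H¹(A))` ⟹ `σ` acts semisimply on `H^*(U)`**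
(`f : A ⟶ U`, `f₊ζ ≠ 0`; e.g. a Kummer variety resolved). [cite: KahnB2003RatNumAbelianType, Lemme 1.9 p. 982]
[cite: Kahn2020, §6.14 SS^i(X, l)] -/
theorem forall_isSemisimple_ρ_of_dominated_by_abelianVariety (hA : IsSmoothProjective g A.X)
    (hU : IsSmoothProjective M U) (f : A.X ⟶ U) {r : ℕ} {ζ : E.obj A.X (2 * r)}
    (hζ : ζ ∈ E.ratAlgebraicClasses A.X r) {he : 2 * r + 2 * M = 2 * g} {hd : 0 + 2 * M = 2 * M}
    (hne : E.pushforward (N := g) hU f he hd ζ ≠ 0) (σ : Field.absoluteGaloisGroup k)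
    (h1 : Module.End.IsSemisimple (E.ρ A.X 1 σ)) (i : ℕ) : Module.End.IsSemisimple (E.ρ U i σ) :=
  E.isSemisimple_ρ_of_pushforward_ne_zero hA hU f hζ hne σ
    (E.isSemisimple_ρ_abelianVariety_of_one A hA σ h1 i)

/-- **`U` dominated by a product `A × B` of abelian varieties with `SS(H¹(A))`, `SS(H¹(B))` ⟹ `σ`
acts semisimply on `H^*(U)`.** [cite: KahnB2003RatNumAbelianType, Lemme 1.9 p. 982] [cite: Kahn2020, §6.14 SS^i(X, l)] -/
theorem forall_isSemisimple_ρ_of_dominated_by_prod_abelianVariety (hA : IsSmoothProjective g A.X)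
    (hB : IsSmoothProjective g' B.X) (hU : IsSmoothProjective M U) (f : A.X ⊗ B.X ⟶ U) {r : ℕ}
    {ζ : E.obj (A.X ⊗ B.X) (2 * r)} (hζ : ζ ∈ E.ratAlgebraicClasses (A.X ⊗ B.X) r)
    {he : 2 * r + 2 * M = 2 * (g + g')} {hd : 0 + 2 * M = 2 * M}
    (hne : E.pushforward (N := g + g') hU f he hd ζ ≠ 0) (σ : Field.absoluteGaloisGroup k)
    (hA1 : Module.End.IsSemisimple (E.ρ A.X 1 σ)) (hB1 : Module.End.IsSemisimple (E.ρ B.X 1 σ))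
    (i : ℕ) : Module.End.IsSemisimple (E.ρ U i σ) :=
  E.isSemisimple_ρ_of_pushforward_ne_zero (IsSmoothProjective.tensor_holds hA hB) hU f hζ hne σ
    (E.isSemisimple_ρ_prod_abelianVariety_of_one A B hA hB σ hA1 hB1 i)

variable {C C₁ C₂ : SchemeOver k}

/-- **`U` dominated by a curve `C` with `SS(H¹(C))` ⟹ `σ` acts semisimply on `H^*(U)`.**
[cite: KahnB2003RatNumAbelianType, Lemme 1.9 p. 982 («ou de courbes, c'est la même chose»)] -/
theorem forall_isSemisimple_ρ_of_dominated_by_curve (hC : IsSmoothProjective 1 C)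
    (hU : IsSmoothProjective M U) (f : C ⟶ U) {r : ℕ} {ζ : E.obj C (2 * r)}
    (hζ : ζ ∈ E.ratAlgebraicClasses C r) {he : 2 * r + 2 * M = 2 * 1} {hd : 0 + 2 * M = 2 * M}
    (hne : E.pushforward (N := 1) hU f he hd ζ ≠ 0) (σ : Field.absoluteGaloisGroup k)
    (h1 : Module.End.IsSemisimple (E.ρ C 1 σ)) (i : ℕ) : Module.End.IsSemisimple (E.ρ U i σ) :=
  E.isSemisimple_ρ_of_pushforward_ne_zero hC hU f hζ hne σ
    (E.forall_isSemisimple_ρ_curve_of_one hC σ h1 i)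

/-- **`U` dominated by a product of two curves with `SS(H¹(C₁))`, `SS(H¹(C₂))` ⟹ `σ` acts
semisimply on `H^*(U)`** (e.g. surfaces dominated by a product of curves).
[cite: KahnB2003RatNumAbelianType, Lemme 1.9 p. 982] [cite: Kahn2020, §6.14 Th. 6.54] -/
theorem forall_isSemisimple_ρ_of_dominated_by_prod_curve (hC₁ : IsSmoothProjective 1 C₁)
    (hC₂ : IsSmoothProjective 1 C₂) (hU : IsSmoothProjective M U) (f : C₁ ⊗ C₂ ⟶ U) {r : ℕ}
    {ζ : E.obj (C₁ ⊗ C₂) (2 * r)} (hζ : ζ ∈ E.ratAlgebraicClasses (C₁ ⊗ C₂) r)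
    {he : 2 * r + 2 * M = 2 * (1 + 1)} {hd : 0 + 2 * M = 2 * M}
    (hne : E.pushforward (N := 1 + 1) hU f he hd ζ ≠ 0) (σ : Field.absoluteGaloisGroup k)
    (h1 : Module.End.IsSemisimple (E.ρ C₁ 1 σ)) (h2 : Module.End.IsSemisimple (E.ρ C₂ 1 σ))
    (i : ℕ) : Module.End.IsSemisimple (E.ρ U i σ) :=
  E.isSemisimple_ρ_of_pushforward_ne_zero (IsSmoothProjective.tensor_holds hC₁ hC₂) hU f hζ hne σ
    (E.isSemisimple_ρ_tensor_of_forall hC₁ hC₂ σ (E.forall_isSemisimple_ρ_curve_of_one hC₁ σ h1)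
      (E.forall_isSemisimple_ρ_curve_of_one hC₂ σ h2) i)

/-- **Generically finite equidimensional maps** `f : A ⟶ U` from an abelian variety (`f* ≠ 0` in
top degree, e.g. an isogeny onto another abelian variety or a finite map of degree `≠ 0`):
`SS(H¹(A)) ⟹ σ` semisimple on `H^*(U)`. [cite: KahnB2003RatNumAbelianType, Lemme 1.9 p. 982]
[cite: Kleiman1968AlgebraicCycles, Prop. 1.2.4] -/
theorem forall_isSemisimple_ρ_of_pullback_top_ne_zero_abelianVariety (hA : IsSmoothProjective g A.X)
    (hU : IsSmoothProjective g U) (f : A.X ⟶ U) (hf : E.pullback f (2 * g) ≠ 0)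
    (σ : Field.absoluteGaloisGroup k) (h1 : Module.End.IsSemisimple (E.ρ A.X 1 σ)) (i : ℕ) :
    Module.End.IsSemisimple (E.ρ U i σ) :=
  E.isSemisimple_ρ_of_pullback_top_ne_zero hA hU f hf σ
    (E.isSemisimple_ρ_abelianVariety_of_one A hA σ h1 i)

end Galois

/-! ## §2 The Frobenius over a finite field: `SS`, `S`, and `S^{dim U}(U × U)` -/

section Frobenius

variable [Finite k] {g g' : ℕ} (A B : AbelianVariety k)

/-- **`U` dominated by an abelian variety with `SS(H¹(A))` (Weil) ⟹ Frobenius semisimple on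
`H^*(U)`.** [cite: KahnB2003RatNumAbelianType, Lemme 1.9 p. 982] [cite: Kahn2020, §6.14 SS^i(X, l)] -/
theorem forall_isSemisimple_frobAction_of_dominated_by_abelianVariety (hA : IsSmoothProjective g A.X)
    (hU : IsSmoothProjective M U) (f : A.X ⟶ U) {r : ℕ} {ζ : E.obj A.X (2 * r)}
    (hζ : ζ ∈ E.ratAlgebraicClasses A.X r) {he : 2 * r + 2 * M = 2 * g} {hd : 0 + 2 * M = 2 * M}
    (hne : E.pushforward (N := g) hU f he hd ζ ≠ 0)
    (h1 : Module.End.IsSemisimple (E.frobAction A.X 1)) (i : ℕ) :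
    Module.End.IsSemisimple (E.frobAction U i) :=
  E.forall_isSemisimple_ρ_of_dominated_by_abelianVariety A hA hU f hζ hne (geomFrob k) h1 i

/-- **… hence `S` for every twisted Frobenius on `H^*(U)`** («SS ⟹ S»).
[cite: Kahn2020, §6.14 p. 132 («SS^{2i} ⟹ S^i»)] [cite: KahnB2003RatNumAbelianType, Lemme 1.9 p. 982] -/
theorem ker_inf_range_eq_bot_of_dominated_by_abelianVariety (hA : IsSmoothProjective g A.X)
    (hU : IsSmoothProjective M U) (f : A.X ⟶ U) {r : ℕ} {ζ : E.obj A.X (2 * r)}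
    (hζ : ζ ∈ E.ratAlgebraicClasses A.X r) {he : 2 * r + 2 * M = 2 * g} {hd : 0 + 2 * M = 2 * M}
    (hne : E.pushforward (N := g) hU f he hd ζ ≠ 0)
    (h1 : Module.End.IsSemisimple (E.frobAction A.X 1)) (i : ℕ) (j : ℤ) :
    LinearMap.ker (E.ρTwist U i j (geomFrob k) - 1) ⊓
      LinearMap.range (E.ρTwist U i j (geomFrob k) - 1) = ⊥ :=
  E.ker_inf_range_eq_bot_twist_of_isSemisimple_frobAction U i j
    (E.forall_isSemisimple_frobAction_of_dominated_by_abelianVariety A hA hU f hζ hne h1 i)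

/-- **… and the strong Tate condition `S^{dim U}(U × U)` of Th. 6.54** (indeed `S` for every twisted
Frobenius on `H^*(U × U)`). [cite: Kahn2020, §6.14 Th. 6.54] [cite: KahnB2003RatNumAbelianType, Lemme 1.9 p. 982] -/
theorem ker_inf_range_eq_bot_self_product_of_dominated_by_abelianVariety
    (hA : IsSmoothProjective g A.X) (hU : IsSmoothProjective M U) (f : A.X ⟶ U) {r : ℕ}
    {ζ : E.obj A.X (2 * r)} (hζ : ζ ∈ E.ratAlgebraicClasses A.X r) {he : 2 * r + 2 * M = 2 * g}
    {hd : 0 + 2 * M = 2 * M} (hne : E.pushforward (N := g) hU f he hd ζ ≠ 0)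
    (h1 : Module.End.IsSemisimple (E.frobAction A.X 1)) (e : ℕ) (j : ℤ) :
    LinearMap.ker (E.ρTwist (U ⊗ U) e j (geomFrob k) - 1) ⊓
      LinearMap.range (E.ρTwist (U ⊗ U) e j (geomFrob k) - 1) = ⊥ :=
  have h := E.forall_isSemisimple_frobAction_of_dominated_by_abelianVariety A hA hU f hζ hne h1
  E.ker_inf_range_eq_bot_tensor_of_isSemisimple_frobAction hU hU h h e j

/-- `S^{dim U}(U × U)` in gen-37's indexing `(2M, M)`, for `U` dominated by an abelian variety with
`SS(H¹(A))`. [cite: Kahn2020, §6.14 Th. 6.54] -/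
theorem self_product_strongTate_of_dominated_by_abelianVariety (hA : IsSmoothProjective g A.X)
    (hU : IsSmoothProjective M U) (f : A.X ⟶ U) {r : ℕ} {ζ : E.obj A.X (2 * r)}
    (hζ : ζ ∈ E.ratAlgebraicClasses A.X r) {he : 2 * r + 2 * M = 2 * g} {hd : 0 + 2 * M = 2 * M}
    (hne : E.pushforward (N := g) hU f he hd ζ ≠ 0)
    (h1 : Module.End.IsSemisimple (E.frobAction A.X 1)) :
    LinearMap.ker (E.ρTwist (U ⊗ U) (2 * M) M (geomFrob k) - 1) ⊓
      LinearMap.range (E.ρTwist (U ⊗ U) (2 * M) M (geomFrob k) - 1) = ⊥ :=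
  E.ker_inf_range_eq_bot_self_product_of_isSemisimple_frobAction hU
    (E.forall_isSemisimple_frobAction_of_dominated_by_abelianVariety A hA hU f hζ hne h1)

/-- **`U` dominated by `A × B` with `SS(H¹(A))`, `SS(H¹(B))` ⟹ Frobenius semisimple on `H^*(U)`.**
[cite: KahnB2003RatNumAbelianType, Lemme 1.9 p. 982] [cite: Kahn2020, §6.14 Th. 6.54] -/
theorem forall_isSemisimple_frobAction_of_dominated_by_prod_abelianVariety
    (hA : IsSmoothProjective g A.X) (hB : IsSmoothProjective g' B.X) (hU : IsSmoothProjective M U)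
    (f : A.X ⊗ B.X ⟶ U) {r : ℕ} {ζ : E.obj (A.X ⊗ B.X) (2 * r)}
    (hζ : ζ ∈ E.ratAlgebraicClasses (A.X ⊗ B.X) r) {he : 2 * r + 2 * M = 2 * (g + g')}
    {hd : 0 + 2 * M = 2 * M} (hne : E.pushforward (N := g + g') hU f he hd ζ ≠ 0)
    (hA1 : Module.End.IsSemisimple (E.frobAction A.X 1))
    (hB1 : Module.End.IsSemisimple (E.frobAction B.X 1)) (i : ℕ) :
    Module.End.IsSemisimple (E.frobAction U i) :=
  E.forall_isSemisimple_ρ_of_dominated_by_prod_abelianVariety A B hA hB hU f hζ hne (geomFrob k)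
    hA1 hB1 i

/-- … hence `S` for every twisted Frobenius on `H^*(U)` and on `H^*(U × U)`, for `U` dominated by
`A × B`. [cite: Kahn2020, §6.14 Th. 6.54] [cite: KahnB2003RatNumAbelianType, Lemme 1.9 p. 982] -/
theorem ker_inf_range_eq_bot_self_product_of_dominated_by_prod_abelianVariety
    (hA : IsSmoothProjective g A.X) (hB : IsSmoothProjective g' B.X) (hU : IsSmoothProjective M U)
    (f : A.X ⊗ B.X ⟶ U) {r : ℕ} {ζ : E.obj (A.X ⊗ B.X) (2 * r)}
    (hζ : ζ ∈ E.ratAlgebraicClasses (A.X ⊗ B.X) r) {he : 2 * r + 2 * M = 2 * (g + g')}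
    {hd : 0 + 2 * M = 2 * M} (hne : E.pushforward (N := g + g') hU f he hd ζ ≠ 0)
    (hA1 : Module.End.IsSemisimple (E.frobAction A.X 1))
    (hB1 : Module.End.IsSemisimple (E.frobAction B.X 1)) (e : ℕ) (j : ℤ) :
    LinearMap.ker (E.ρTwist (U ⊗ U) e j (geomFrob k) - 1) ⊓
        LinearMap.range (E.ρTwist (U ⊗ U) e j (geomFrob k) - 1) = ⊥ ∧
      LinearMap.ker (E.ρTwist U e j (geomFrob k) - 1) ⊓
        LinearMap.range (E.ρTwist U e j (geomFrob k) - 1) = ⊥ :=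
  have h := E.forall_isSemisimple_frobAction_of_dominated_by_prod_abelianVariety A B hA hB hU f hζ
    hne hA1 hB1
  ⟨E.ker_inf_range_eq_bot_tensor_of_isSemisimple_frobAction hU hU h h e j,
    E.ker_inf_range_eq_bot_twist_of_isSemisimple_frobAction U e j (h e)⟩

variable {C C₁ C₂ : SchemeOver k}

/-- **`U` dominated by a curve with `SS(H¹(C))` ⟹ Frobenius semisimple on `H^*(U)` and `S` for every
twisted Frobenius on `H^*(U)`, `H^*(U × U)`.** [cite: KahnB2003RatNumAbelianType, Lemme 1.9 p. 982]
[cite: Kahn2020, §6.14 Th. 6.54] -/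
theorem semisimple_and_strongTate_of_dominated_by_curve (hC : IsSmoothProjective 1 C)
    (hU : IsSmoothProjective M U) (f : C ⟶ U) {r : ℕ} {ζ : E.obj C (2 * r)}
    (hζ : ζ ∈ E.ratAlgebraicClasses C r) {he : 2 * r + 2 * M = 2 * 1} {hd : 0 + 2 * M = 2 * M}
    (hne : E.pushforward (N := 1) hU f he hd ζ ≠ 0)
    (h1 : Module.End.IsSemisimple (E.frobAction C 1)) (e : ℕ) (j : ℤ) :
    Module.End.IsSemisimple (E.frobAction U e) ∧
      LinearMap.ker (E.ρTwist U e j (geomFrob k) - 1) ⊓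
          LinearMap.range (E.ρTwist U e j (geomFrob k) - 1) = ⊥ ∧
        LinearMap.ker (E.ρTwist (U ⊗ U) e j (geomFrob k) - 1) ⊓
          LinearMap.range (E.ρTwist (U ⊗ U) e j (geomFrob k) - 1) = ⊥ :=
  have h : ∀ i, Module.End.IsSemisimple (E.frobAction U i) :=
    E.forall_isSemisimple_ρ_of_dominated_by_curve hC hU f hζ hne (geomFrob k) h1
  ⟨h e, E.ker_inf_range_eq_bot_twist_of_isSemisimple_frobAction U e j (h e),
    E.ker_inf_range_eq_bot_tensor_of_isSemisimple_frobAction hU hU h h e j⟩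

/-- **`U` dominated by a product of two curves with `SS(H¹(Cᵢ))` ⟹ Frobenius semisimple on
`H^*(U)`, `S` for every twisted Frobenius on `H^*(U)` and `H^*(U × U)`** (surfaces dominated by a
product of curves). [cite: KahnB2003RatNumAbelianType, Lemme 1.9 p. 982] [cite: Kahn2020, §6.14 Th. 6.54] -/
theorem semisimple_and_strongTate_of_dominated_by_prod_curve (hC₁ : IsSmoothProjective 1 C₁)
    (hC₂ : IsSmoothProjective 1 C₂) (hU : IsSmoothProjective M U) (f : C₁ ⊗ C₂ ⟶ U) {r : ℕ}
    {ζ : E.obj (C₁ ⊗ C₂) (2 * r)} (hζ : ζ ∈ E.ratAlgebraicClasses (C₁ ⊗ C₂) r)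
    {he : 2 * r + 2 * M = 2 * (1 + 1)} {hd : 0 + 2 * M = 2 * M}
    (hne : E.pushforward (N := 1 + 1) hU f he hd ζ ≠ 0)
    (h1 : Module.End.IsSemisimple (E.frobAction C₁ 1))
    (h2 : Module.End.IsSemisimple (E.frobAction C₂ 1)) (e : ℕ) (j : ℤ) :
    Module.End.IsSemisimple (E.frobAction U e) ∧
      LinearMap.ker (E.ρTwist U e j (geomFrob k) - 1) ⊓
          LinearMap.range (E.ρTwist U e j (geomFrob k) - 1) = ⊥ ∧
        LinearMap.ker (E.ρTwist (U ⊗ U) e j (geomFrob k) - 1) ⊓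
          LinearMap.range (E.ρTwist (U ⊗ U) e j (geomFrob k) - 1) = ⊥ :=
  have h : ∀ i, Module.End.IsSemisimple (E.frobAction U i) :=
    E.forall_isSemisimple_ρ_of_dominated_by_prod_curve hC₁ hC₂ hU f hζ hne (geomFrob k) h1 h2
  ⟨h e, E.ker_inf_range_eq_bot_twist_of_isSemisimple_frobAction U e j (h e),
    E.ker_inf_range_eq_bot_tensor_of_isSemisimple_frobAction hU hU h h e j⟩

end Frobenius

end GaloisWeilCohomology

end Literature.AlgebraicGeometry.Motives

end
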